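import Mathlib.Algebra.Lie.UniversalEnveloping
import Mathlib.Algebra.Lie.InvariantForm
import Mathlib.LinearAlgebra.BilinearForm.Properties
import Mathlib.LinearAlgebra.TensorAlgebra.Basic
import Mathlib.Tactic.NoncommRing
import HarnessLib

/-!
# The Casimir element of an invariant non-degenerate symmetric bilinear form

Topic `Algebra/Lie`. Let `L` be a Lie algebra over a field `K` with a finite basis `b`, and let
`B` be a non-degenerate symmetric bilinear form on `L` which is *invariant*
(`B ⁅x, y⁆ z = - B y ⁅x, z⁆`, Mathlib's `LinearMap.BilinForm.lieInvariant`). With the `B`-dual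
basis `bⁱ = B.dualBasis hB b i` (`B bⁱ bⱼ = δᵢⱼ`), the **Casimir element** is
`C_B = ∑ᵢ ι(bᵢ) ι(bⁱ) ∈ U(L)` (Bourbaki, *Lie Groups and Lie Algebras* I, §3.7; Humphreys 1972,
§6.2; Knapp 2002, V.§4, (5.24)). This file proves the classical facts about it in the form
needed for invariant differential operators:

* `sum_basis_dualBasis_eq` — for every bilinear map `Φ : L × L → W`, the sum `∑ᵢ Φ bᵢ bⁱ` does not
  depend on the basis `b` (it is the image of the canonical element of `L ⊗ L` defined by `B`);
  `dualBasis_map` — a linear automorphism preserving `B` maps dual bases to dual bases, whence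
  `∑ᵢ Φ (e bᵢ) (e bⁱ) = ∑ᵢ Φ bᵢ bⁱ` (`sum_map_basis_dualBasis_eq`);
* `sum_lie_basis_dualBasis_eq_neg` — `∑ᵢ Φ ⁅x, bᵢ⁆ bⁱ = - ∑ᵢ Φ bᵢ ⁅x, bⁱ⁆` for invariant `B`;
* `casimirElement B hB b` and `casimirElement_eq` (independence of `b`),
  `ι_mul_casimirElement` (`ι x · C = C · ι x`), `casimirElement_mem_center` (`C ∈ Z(U(L))`;
  `mem_center_of_forall_ι_comm`: an element commuting with `ι(L)` is central).

Mathlib has the universal enveloping algebra (`UniversalEnvelopingAlgebra`, `ι`, `lift`), dual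
bases of non-degenerate bilinear forms (`LinearMap.BilinForm.dualBasis`) and invariant forms
(`LinearMap.BilinForm.lieInvariant`), but no Casimir element (searched: `casimir`, `Casimir` —
only the `sl₂` operator `4FE + H² + 2H` of `Literature/Algebra/Lie/Sl2Strings` and the explicit
`gl_n` Casimirs `tr(𝔼^k)` of `Literature/NumberTheory/Automorphic/HarishChandraCore`, neither of
which is the element attached to a bilinear form).

## References

* N. Bourbaki, *Lie Groups and Lie Algebras*, Ch. I, §3.7 (Casimir element).
* J. E. Humphreys, *Introduction to Lie Algebras and Representation Theory* (1972), §6.2.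
* A. W. Knapp, *Lie Groups Beyond an Introduction*, 2nd ed. (2002), V.§4, (5.24)–(5.25).
-/

noncomputable section

-- Mathlib idiom (Mathlib/Algebra/Lie/OfAssociative.lean, UniversalEnveloping.lean): commutator brackets
attribute [local instance 100] LieRing.ofAssociativeRing

namespace Literature.Algebra.Lie

variable {K : Type*} [Field K] {L : Type*} [LieRing L] [LieAlgebra K L]
  {ι' : Type*} [Fintype ι'] [DecidableEq ι'] {κ : Type*} [Fintype κ] [DecidableEq κ]
  {W : Type*} [AddCommGroup W] [Module K W]

/-! ### Basis independence of `∑ᵢ Φ bᵢ bⁱ` -/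

section Independence

variable {B : LinearMap.BilinForm K L} (hB : B.Nondegenerate) (hBs : B.IsSymm)

include hBs in
/-- Coordinates in a basis `b` are the pairings with the `B`-dual basis:
`b.repr x i = B x bⁱ` (for symmetric non-degenerate `B`). [folklore] -/
theorem basis_repr_eq_apply_dualBasis (b : Module.Basis ι' K L) (x : L) (i : ι') :
    b.repr x i = B x (B.dualBasis hB b i) := by
  conv_lhs => rw [← LinearMap.BilinForm.dualBasis_dualBasis hB hBs b]
  rw [LinearMap.BilinForm.dualBasis_repr_apply]

include hBs in
/-- Expansion in a basis: `x = ∑ᵢ B x bⁱ • bᵢ`. [folklore] -/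
theorem sum_apply_dualBasis_smul_basis (b : Module.Basis ι' K L) (x : L) :
    ∑ i, B x (B.dualBasis hB b i) • b i = x := by
  conv_rhs => rw [← b.sum_repr x]
  simp_rw [basis_repr_eq_apply_dualBasis hB hBs]

/-- Expansion in the dual basis: `x = ∑ᵢ B x bᵢ • bⁱ`. [folklore] -/
theorem sum_apply_basis_smul_dualBasis (b : Module.Basis ι' K L) (x : L) :
    ∑ i, B x (b i) • B.dualBasis hB b i = x := by
  conv_rhs => rw [← (B.dualBasis hB b).sum_repr x]
  simp_rw [LinearMap.BilinForm.dualBasis_repr_apply]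

include hBs in
/-- **Basis independence of the canonical element.** For every `K`-bilinear `Φ : L × L → W` and
any two finite bases `b`, `c` of `L`: `∑ᵢ Φ bᵢ bⁱ = ∑ⱼ Φ cⱼ cʲ` (`bⁱ`, `cʲ` the `B`-dual bases).
Bourbaki, LIE I §3.7; Knapp 2002, (5.25). [folklore] -/
theorem sum_basis_dualBasis_eq (Φ : L →ₗ[K] L →ₗ[K] W) (b : Module.Basis ι' K L)
    (c : Module.Basis κ K L) :
    ∑ i, Φ (b i) (B.dualBasis hB b i) = ∑ j, Φ (c j) (B.dualBasis hB c j) := by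
  -- coefficients of `c j` in the basis `b`, and of `cʲ` in the dual basis `bⁱ`
  set a : κ → ι' → K := fun j i => B (c j) (B.dualBasis hB b i) with ha
  set e : κ → ι' → K := fun j k => B (B.dualBasis hB c j) (b k) with he
  have hc : ∀ j, c j = ∑ i, a j i • b i :=
    fun j => (sum_apply_dualBasis_smul_basis hB hBs b (c j)).symm
  have hc' : ∀ j, B.dualBasis hB c j = ∑ k, e j k • B.dualBasis hB b k :=
    fun j => (sum_apply_basis_smul_dualBasis hB b _).symm
  -- the matrices `a`, `e` are inverse to each other
  have key : ∀ i k, ∑ j, a j i * e j k = if k = i then 1 else 0 := by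
    intro i k
    have h1 : ∑ j, e j k • c j = b k := by
      calc ∑ j, e j k • c j = ∑ j, c.repr (b k) j • c j := by
            refine Finset.sum_congr rfl fun j _ => ?_
            change B (B.dualBasis hB c j) (b k) • c j = _
            rw [hBs.eq, basis_repr_eq_apply_dualBasis hB hBs c]
        _ = b k := c.sum_repr _
    calc ∑ j, a j i * e j k
        = B (∑ j, e j k • c j) (B.dualBasis hB b i) := by
          rw [map_sum, LinearMap.sum_apply]
          refine Finset.sum_congr rfl fun j _ => ?_
          rw [map_smul, LinearMap.smul_apply, smul_eq_mul, mul_comm]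
      _ = if k = i then 1 else 0 := by
          rw [h1, LinearMap.BilinForm.apply_dualBasis_right hB hBs]
  -- expansion of `Φ (c j) (cʲ)` in the `b`-data
  have expand : ∀ j, Φ (c j) (B.dualBasis hB c j) =
      ∑ i, ∑ k, (a j i * e j k) • Φ (b i) (B.dualBasis hB b k) := by
    intro j
    conv_lhs => rw [hc j, hc' j]
    rw [map_sum Φ (fun i => a j i • b i) Finset.univ, LinearMap.sum_apply]
    refine Finset.sum_congr rfl fun i _ => ?_
    rw [map_smul Φ, LinearMap.smul_apply, map_sum (Φ (b i)), Finset.smul_sum]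
    refine Finset.sum_congr rfl fun k _ => ?_
    rw [map_smul (Φ (b i)), smul_smul]
  symm
  calc ∑ j, Φ (c j) (B.dualBasis hB c j)
      = ∑ j, ∑ i, ∑ k, (a j i * e j k) • Φ (b i) (B.dualBasis hB b k) := by
        simp_rw [expand]
    _ = ∑ i, ∑ j, ∑ k, (a j i * e j k) • Φ (b i) (B.dualBasis hB b k) := Finset.sum_comm
    _ = ∑ i, ∑ k, ∑ j, (a j i * e j k) • Φ (b i) (B.dualBasis hB b k) :=
        Finset.sum_congr rfl fun i _ => Finset.sum_comm
    _ = ∑ i, ∑ k, (if k = i then (1 : K) else 0) • Φ (b i) (B.dualBasis hB b k) := by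
        refine Finset.sum_congr rfl fun i _ => Finset.sum_congr rfl fun k _ => ?_
        rw [← Finset.sum_smul, key]
    _ = ∑ i, Φ (b i) (B.dualBasis hB b i) := by
        refine Finset.sum_congr rfl fun i _ => ?_
        rw [Finset.sum_eq_single i (fun k _ hk => by rw [if_neg hk, zero_smul])
          (fun h => (h (Finset.mem_univ i)).elim), if_pos rfl, one_smul]

/-- **A `B`-orthogonal automorphism maps dual bases to dual bases**: if `e : L ≃ₗ L` preserves
`B`, then `B.dualBasis hB (b.map e) = (B.dualBasis hB b).map e`. [folklore] -/
theorem dualBasis_map (b : Module.Basis ι' K L) (e : L ≃ₗ[K] L)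
    (he : ∀ x y, B (e x) (e y) = B x y) :
    B.dualBasis hB (b.map e) = (B.dualBasis hB b).map e := by
  refine Module.Basis.eq_of_apply_eq fun i => ?_
  have key : ⇑(B.dualBasis hB (b.map e)) = ⇑((B.dualBasis hB b).map e) :=
    (LinearMap.BilinForm.dualBasis_eq_iff hB (b.map e) _).2 fun i j => by
      rw [Module.Basis.map_apply, Module.Basis.map_apply, he,
        LinearMap.BilinForm.apply_dualBasis_left]
  exact congrFun key i

include hBs in
/-- **Invariance of the canonical element under `B`-orthogonal automorphisms**:
`∑ᵢ Φ (e bᵢ) (e bⁱ) = ∑ᵢ Φ bᵢ bⁱ` for `e : L ≃ₗ L` preserving `B` (e.g. `e = Ad g`).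
Knapp 2002, V.§4. [folklore] -/
theorem sum_map_basis_dualBasis_eq (Φ : L →ₗ[K] L →ₗ[K] W) (b : Module.Basis ι' K L)
    (e : L ≃ₗ[K] L) (he : ∀ x y, B (e x) (e y) = B x y) :
    ∑ i, Φ (e (b i)) (e (B.dualBasis hB b i)) = ∑ i, Φ (b i) (B.dualBasis hB b i) := by
  have h := sum_basis_dualBasis_eq hB hBs Φ (b.map e) b
  rw [dualBasis_map hB b e he] at h
  simpa only [Module.Basis.map_apply] using h

include hBs in
/-- **Invariance of the canonical element under the Lie algebra**: for an invariant symmetric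
non-degenerate `B` and every bilinear `Φ`, `∑ᵢ Φ ⁅x, bᵢ⁆ bⁱ = - ∑ᵢ Φ bᵢ ⁅x, bⁱ⁆`.
Bourbaki, LIE I §3.7, Prop. 11; Humphreys 1972, §6.2. [folklore] -/
theorem sum_lie_basis_dualBasis_eq_neg (hBi : B.lieInvariant L) (Φ : L →ₗ[K] L →ₗ[K] W)
    (b : Module.Basis ι' K L) (x : L) :
    ∑ i, Φ ⁅x, b i⁆ (B.dualBasis hB b i) = -∑ i, Φ (b i) ⁅x, B.dualBasis hB b i⁆ := by
  set d := B.dualBasis hB b with hd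
  -- expansions of the brackets
  have h1 : ∀ i, ⁅x, b i⁆ = ∑ j, B ⁅x, b i⁆ (d j) • b j :=
    fun i => (sum_apply_dualBasis_smul_basis hB hBs b _).symm
  have h2 : ∀ i, ⁅x, d i⁆ = ∑ j, B ⁅x, d i⁆ (b j) • d j :=
    fun i => (sum_apply_basis_smul_dualBasis hB b _).symm
  -- the coefficient identity from invariance and symmetry
  have hcoef : ∀ i j, B ⁅x, b i⁆ (d j) = -B ⁅x, d j⁆ (b i) := by
    intro i j
    rw [hBi, hBs.eq]
  calc ∑ i, Φ ⁅x, b i⁆ (d i)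
      = ∑ i, ∑ j, B ⁅x, b i⁆ (d j) • Φ (b j) (d i) := by
        refine Finset.sum_congr rfl fun i _ => ?_
        conv_lhs => rw [h1 i]
        rw [map_sum, LinearMap.sum_apply]
        refine Finset.sum_congr rfl fun j _ => ?_
        rw [map_smul, LinearMap.smul_apply]
    _ = ∑ i, ∑ j, -(B ⁅x, d j⁆ (b i) • Φ (b j) (d i)) := by
        simp_rw [hcoef, neg_smul]
    _ = -∑ j, ∑ i, B ⁅x, d j⁆ (b i) • Φ (b j) (d i) := by
        rw [Finset.sum_comm]
        simp_rw [Finset.sum_neg_distrib]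
    _ = -∑ j, Φ (b j) ⁅x, d j⁆ := by
        congr 1
        refine Finset.sum_congr rfl fun j _ => ?_
        conv_rhs => rw [h2 j]
        rw [map_sum]
        refine Finset.sum_congr rfl fun i _ => ?_
        rw [map_smul]

end Independence

/-! ### The Casimir element of `U(L)` -/

section Casimir

open UniversalEnvelopingAlgebra

variable (B : LinearMap.BilinForm K L) (hB : B.Nondegenerate)

/-- The **Casimir element** `C_B = ∑ᵢ ι(bᵢ) ι(bⁱ) ∈ U(L)` of the non-degenerate bilinear form
`B`, computed in the basis `b` with `B`-dual basis `bⁱ = B.dualBasis hB b i` (independent of `b`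
for symmetric `B`: `casimirElement_eq`). Bourbaki, LIE I §3.7; Humphreys 1972, §6.2;
Knapp 2002, (5.24). [folklore] -/
def casimirElement (b : Module.Basis ι' K L) : UniversalEnvelopingAlgebra K L :=
  ∑ i, ι K (b i) * ι K (B.dualBasis hB b i)

variable {B hB}

variable (K L) in
/-- Multiplication of generators `(x, y) ↦ ι x · ι y`, a bilinear map `L × L → U(L)`. [folklore] -/
def ιMul : L →ₗ[K] L →ₗ[K] UniversalEnvelopingAlgebra K L :=
  (LinearMap.mul K (UniversalEnvelopingAlgebra K L)).compl₁₂ (ι K : L →ₗ⁅K⁆ _).toLinearMap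
    (ι K : L →ₗ⁅K⁆ _).toLinearMap

/-- `ιMul x y = ι x * ι y`. [folklore] -/
@[simp]
theorem ιMul_apply (x y : L) : ιMul K L x y = ι K x * ι K y := rfl

/-- The Casimir element as the value of the bilinear map `ιMul`. [folklore] -/
theorem casimirElement_eq_sum_ιMul (b : Module.Basis ι' K L) :
    casimirElement B hB b = ∑ i, ιMul K L (b i) (B.dualBasis hB b i) := rfl

/-- **The Casimir element does not depend on the basis** (for symmetric `B`).
Bourbaki, LIE I §3.7; Knapp 2002, (5.25). [folklore] -/
theorem casimirElement_eq (hBs : B.IsSymm) (b : Module.Basis ι' K L) (c : Module.Basis κ K L) :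
    casimirElement B hB b = casimirElement B hB c := by
  rw [casimirElement_eq_sum_ιMul, casimirElement_eq_sum_ιMul]
  exact sum_basis_dualBasis_eq hB hBs (ιMul K L) b c

/-- **Generators commute with the Casimir element**: `ι x · C = C · ι x` for invariant symmetric
non-degenerate `B`. Bourbaki, LIE I §3.7, Prop. 11; Humphreys 1972, §6.2, Lemma. [folklore] -/
theorem ι_mul_casimirElement (hBs : B.IsSymm) (hBi : B.lieInvariant L) (b : Module.Basis ι' K L)
    (x : L) : ι K x * casimirElement B hB b = casimirElement B hB b * ι K x := by
  -- `ι x (ι y ι z) - (ι y ι z) ι x = ι ⁅x, y⁆ ι z + ι y ι ⁅x, z⁆`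
  have hbr : ∀ y z : L, ι K x * (ι K y * ι K z) - ι K y * ι K z * ι K x =
      ι K ⁅x, y⁆ * ι K z + ι K y * ι K ⁅x, z⁆ := by
    intro y z
    rw [LieHom.map_lie, LieHom.map_lie, LieRing.of_associative_ring_bracket,
      LieRing.of_associative_ring_bracket]
    noncomm_ring
  rw [← sub_eq_zero, casimirElement, Finset.mul_sum, Finset.sum_mul, ← Finset.sum_sub_distrib]
  simp_rw [hbr, Finset.sum_add_distrib]
  have h := sum_lie_basis_dualBasis_eq_neg hB hBs hBi (ιMul K L) b x
  simp only [ιMul_apply] at h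
  rw [h, neg_add_cancel]

/-- An element of `U(L)` commuting with every generator `ι x` is central (the `ι x` generate
`U(L)` as an algebra). [folklore] -/
theorem mem_center_of_forall_ι_comm {u : UniversalEnvelopingAlgebra K L}
    (h : ∀ x : L, ι K x * u = u * ι K x) :
    u ∈ Subalgebra.center K (UniversalEnvelopingAlgebra K L) := by
  rw [Subalgebra.mem_center_iff]
  intro w
  obtain ⟨t, rfl⟩ : ∃ t, mkAlgHom K L t = w := RingCon.mkₐ_surjective _ w
  induction t using TensorAlgebra.induction with
  | algebraMap r => rw [AlgHom.commutes, Algebra.commutes]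
  | ι x =>
    have hx : mkAlgHom K L (TensorAlgebra.ι K x) = ι K x := rfl
    rw [hx]
    exact h x
  | mul a c ha hc => rw [map_mul, mul_assoc, hc, ← mul_assoc, ha, mul_assoc]
  | add a c ha hc => rw [map_add, add_mul, mul_add, ha, hc]

/-- **The Casimir element is central in `U(L)`** (invariant symmetric non-degenerate `B`).
Bourbaki, LIE I §3.7, Prop. 11; Humphreys 1972, §6.2; Knapp 2002, Prop. 5.24. [folklore] -/
theorem casimirElement_mem_center (hBs : B.IsSymm) (hBi : B.lieInvariant L)
    (b : Module.Basis ι' K L) :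
    casimirElement B hB b ∈ Subalgebra.center K (UniversalEnvelopingAlgebra K L) :=
  mem_center_of_forall_ι_comm fun x => ι_mul_casimirElement hBs hBi b x

end Casimir

end Literature.Algebra.Lie
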